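import Summits.CriticalPhenomena.PercolationContinuityZ3.Theorems.Transplant.SkelFrmBParamsFaceFloorsPinSYA
import Summits.CriticalPhenomena.PercolationContinuityZ3.Theorems.Transplant.SkelFrmBParamsFaceFloorsLAdYA
import Summits.CriticalPhenomena.PercolationContinuityZ3.Theorems.Transplant.SkelFrmBParamsFaceOriginsYLA
import Summits.CriticalPhenomena.PercolationContinuityZ3.Theorems.Transplant.SkelFrmBParamsFaceOriginsXA
import Summits.CriticalPhenomena.PercolationContinuityZ3.Theorems.Transplant.SkelFrmBParamsFaceOriginsYA
import Summits.CriticalPhenomena.PercolationContinuityZ3.Theorems.Transplant.SkelFrmBParamsFramesF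
import Summits.CriticalPhenomena.PercolationContinuityZ3.Theorems.Transplant.SkelFrmBParamsFaceFloorsClrYF
import Summits.CriticalPhenomena.PercolationContinuityZ3.Theorems.Transplant.SkelFrmBParamsFaceFloorsClrYA
import Summits.CriticalPhenomena.PercolationContinuityZ3.Theorems.Transplant.SkelFrmBParamsFaceFloorsFAYA
import Summits.CriticalPhenomena.PercolationContinuityZ3.Theorems.Transplant.SkelFrmBParamsFaceFloorsFBYA
import Summits.CriticalPhenomena.PercolationContinuityZ3.Theorems.Transplant.SkelFrmBParamsFaceFloorsFTYA
import Summits.CriticalPhenomena.PercolationContinuityZ3.Theorems.Transplant.SkelFrmBParamsFaceFloorsLYA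
import Summits.CriticalPhenomena.PercolationContinuityZ3.Theorems.Transplant.SkelFrmBParamsFaceFloorsQYA
import Summits.CriticalPhenomena.PercolationContinuityZ3.Theorems.Transplant.SkelFrmBParamsFaceFloorsZPiYA
import Summits.CriticalPhenomena.PercolationContinuityZ3.Theorems.Transplant.SkelFrmBParamsFaceFloorsZYA
import Summits.CriticalPhenomena.PercolationContinuityZ3.Theorems.Transplant.SkelFrmBParamsFaceFloorsPinYA
import Summits.CriticalPhenomena.PercolationContinuityZ3.Theorems.Transplant.SkelFrmBParamsFaceCountsYA
import Summits.CriticalPhenomena.PercolationContinuityZ3.Theorems.Transplant.SkelFrmBParamsFaceCountsRangeYA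
import Summits.CriticalPhenomena.PercolationContinuityZ3.Theorems.Transplant.SkelFrmBParamsFaceCountsShiftYA
import Summits.CriticalPhenomena.PercolationContinuityZ3.Theorems.Transplant.SkelPhiFaceNumsYP2T
import Summits.CriticalPhenomena.PercolationContinuityZ3.Theorems.Transplant.SkelFrmBChoiceWindow
import Summits.CriticalPhenomena.PercolationContinuityZ3.Theorems.Transplant.PlanarSkeletonFrmDefs
import Summits.CriticalPhenomena.PercolationContinuityZ3.Theorems.Transplant.SkelPhiStepIDataNS
import HarnessLib
/-!
(F) VALUE LAYER, N2 twin (hp-8 g42, 2026-08-23; F-DISCHARGE-MAP-N2 G18 — THE y′-FACE ASSEMBLY `Skelφ.FloorsY2T` AT THE (ζ′) TUPLE, bridge case SAME — the only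
live case in N2 by `sel_ori`, (R-41)(b)): `port_frm.py` text of N1 `SkelNegBParamsFaceFloorsY2SA` (stmt-g17/p3-g12) re-fitted: target = the T keystone's
`FloorsY2T` (NumsYP2T, (R-40)) over GENERIC cells `(P : PCells2T) (hP : P.toPCells2 = fcellsA …)` (the discharge file instantiates `P := fcellsT …`,
`hP := fcellsT_toPCells2 …`), window `b₀ := NegB.BSlot.small`, kit radius `KS0.R'0` (J19; `R's = R'₃ := R'0`), counts `NrY/N3Y/σTY … P … du`; every
field by `exact` on the N2 leaf (ZYA `hfR_YA/hZfar_YA`; PinSYA `floorsFA/FB/FT_YA`; LAdYA `floorsFL_YA` (cell unit `P.s 0 = u₀A` by `cells_of_hP`); FaceRunA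
`hq₃Y_RA`; QYA `hW_YA₂`; FramesF `hxaF_s/hxbF_s`; ClrYF `hclrLo/Hi_YFs`; PinYA `hclr₃/hπ2Y/hπ3Y_YA`; origins OriginsXA/YA/YQA/YLA). HYPOTHESES OF RECORD
replacing N1's slot reads: `hMR0`, `hRn0`, `hnA`, `hℓA`, `hS/hS64`, `hs0 : 6R'0+11 ≤ u₀A`, `hs1 : 14R'0+27 ≤ u₁A`, the creep-aware band rows
`hkE8 : kE + 8u₀ + 8 + P.c 1 ≤ 5·P.r 0`, `hkE24h : 2kE + 24u₀ + 24 + 2·P.c 1 ≤ 5·P.r 0` (J21-candidate shape), and the reach floor `hr : πBudY … ≤ r`.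
`rangesY_YFs` (the packager's per-point ranges at `yLFs`) at 240·Kq+10.
NON-VACUITY: all hypotheses are the face frame's rows, Step I at the tuple, or the posted floors (lane 09:33:53Z (1)–(7)).
builds on p205010 (kernel theorem, internal audit signed; external expert review pending); nothing here is a claim about the open node `SamePDropOfSkeletonFrm₁`.
N1 HEADER (kept for the reader):
# N1 (the `{±1}` node), (F) column, M3 — **THE y′-FACE `Skelφ.FloorsY2` ASSEMBLED AT THE (ζ′) TUPLE, bridge case SAME** (`o_b = o_L`, frame `KS.BFs … σh`,
# origin `yL := KS.yLFs c mk g f (sgOf du) σh`, start half-height `qB′ := KS.qBF c mk g f`, `qB₃′ := KS.qB3YA g f (RA′ mk)`, counts `NrY/σTY/N3Y` (hp-8 CountsYA)):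
# all 29 fields, every group by `exact` on its owner's landed lemma — G-Z′/G-π′/G-clr′ p1 (ZPiYA/PinYA/ZPiYA2/ClrYF), G-L′/G-fit′ hp-8 (LYA via stmt's adapters
# `floorsFL_YA` LAdYA, QYA `hW_YA₂`), G-A′/G-T′ stmt (FAYA/FBYA/FTYA via the pins `floorsFA_YA/floorsFB_YA/floorsFT_YA` PinSYA), G-O′ stmt-g16/g17 (FramesF
# `hxaF_s/hxbF_s`, OriginsYA/YQA/YLA readings `Λ_yLFs`, budgets `four_U_qBF_le/two_U_qBF_le`, size `hyl_yLF`), `hq₃` FaceRunA. Skeleton: p3-g12's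
# FloorsY2AssemblyS.dev (10:30Z). Remaining premises are glue-level (as in the x-face X2SA p3-g12): `hN hκ` from `hAt`, slot floors `hnA hℓA hS hS64 hs0 hs1 hkF0 hkF1`,
# the band `E := RlevA + reachA` with `hEu/hE2/hkE/hkE8/hkE24` (`kE := kFF₂ … (E−1) 1`; `hkE24` = FTYA `hkE24_RA₂`), the hop side `σh` with the (L-F1) convention
# `hhopLo/hhopHi`, the bridge-offset index `hc : NrY + 1 ≤ c` (at v3: `NegB.hc_cK κ …` from `NrY_range….2`), and the r-floor `hr`.
# (stmt-g17 2026-08-22; integrator row p3 — filed by stmt per the lead's ruling / with p3's consent, see lane INBOX.)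
builds on p205010 (kernel theorem, internal audit signed; external expert review pending) — nothing in this file uses p205010; NOTHING is claimed about the node
`SamePDropOfSkeletonNeg₁` (OPEN): this is the y′ half of the M3 input of the (F) wrapper, not the wrapper.
Lane `prim-bschramm-*`, seats `prim-bschramm-p3` (skeleton) / `prim-bschramm-stmt` (gen 17, assembly); helper file (`--supports stmt-CriticalPhenomena-4575 --as helper`).
[cite: KozmaNitzan2024, §4 Lemma 11–12 (pp. 21–25)] [cite: MartineauTassion2017, §4.1]
-/

noncomputable section

open scoped Classical

namespace Summit.CriticalPhenomena.PercolationContinuityZ3.Theorems.Transplant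

namespace PlanarSkeletonFrm

namespace NegB

open Literature.Probability.Percolation Literature.Probability.LatticeModels SimpleGraph KNCells KNLevels
open Literature.Probability.Percolation.KozmaNitzan.Cells (oth sgOf sgOf_sign stepVec_apply_fst)
open SkelConc (Consts)
open Skelφ (shearUnit shearUnit_pos)
open Skelφ.StepI (DataN)
open ChainPlanar (BridgePrm)
open TwoAxis.Para (modulus)
open Neg

namespace KS

set_option maxHeartbeats 4000000 in
/-- **M3, y′-face: `Skelφ.FloorsY2` at the (ζ′) tuple, bridge case same (`KS.BFs`)** — all 29 fields at the landing origin `yLFs` of the case (see the module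
docstring for the groups and the remaining glue-level hypotheses). [cite: KozmaNitzan2024, §4 Lemma 11–12 (pp. 21–25)] -/
theorem floorsY2_YFs (κ : Consts) {V : Type} [DecidableEq V] [Countable V] {G : SimpleGraph V} [G.LocallyFinite] (Φ : PlanarSkeletonFrm G) (t : V) (p : unitInterval) (D : Skelφ.StepI.DataNS V) (c : ℕ) (mk : ℕ) (gx : Neg.FSlot) (fx : Neg.FSlot) (P : PCells2T) (hP : P.toPCells2 = fcellsA κ Φ t p D (gT mk gx κ Φ t p D) (fT mk fx κ Φ t p D))
    (hN : EqNumL κ Φ t p D (gT mk gx κ Φ t p D) (fT mk fx κ Φ t p D)) (hκ : (hL κ Φ t p D (gT mk gx κ Φ t p D) (fT mk fx κ Φ t p D)).natAbs ≤ 10 * nL κ Φ t p D (gT mk gx κ Φ t p D) (fT mk fx κ Φ t p D))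
    (hnA : 2000 * Neg.Kq κ * (KS0.R'0 κ Φ t p D mk + 2) ≤ nL κ Φ t p D (gT mk gx κ Φ t p D) (fT mk fx κ Φ t p D))
    (hℓA : 22000 * Neg.Kq κ * (KS0.R'0 κ Φ t p D mk + 2) ≤ ℓL κ Φ t p D (gT mk gx κ Φ t p D) (fT mk fx κ Φ t p D))
    (hS : 16 * SF κ Φ t p D c mk ≤ ML κ Φ t p D (gT mk gx κ Φ t p D)) (hS64 : 64 * SF κ Φ t p D c mk ≤ ML κ Φ t p D (gT mk gx κ Φ t p D))
    (hMR0 : 22000 * (KS0.R'0 κ Φ t p D mk + 2) ≤ ML κ Φ t p D (gT mk gx κ Φ t p D)) (hRn0 : KS0.R'0 κ Φ t p D mk ≤ nL κ Φ t p D (gT mk gx κ Φ t p D) (fT mk fx κ Φ t p D))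
    (hs0 : 6 * (KS0.R'0 κ Φ t p D mk : ℤ) + 11 ≤ u₀A κ Φ t p D (gT mk gx κ Φ t p D) (fT mk fx κ Φ t p D)) (hs1 : 14 * (KS0.R'0 κ Φ t p D mk : ℤ) + 27 ≤ u₁A κ Φ t p D (gT mk gx κ Φ t p D) (fT mk fx κ Φ t p D))
    (hkF0 : kF₀A κ Φ t p D c mk (gT mk gx κ Φ t p D) (fT mk fx κ Φ t p D) ≤ 8 * u₀A κ Φ t p D (gT mk gx κ Φ t p D) (fT mk fx κ Φ t p D) + 1)
    (hkF1 : kF₁A κ Φ t p D c mk (gT mk gx κ Φ t p D) (fT mk fx κ Φ t p D) ≤ 8 * u₁A κ Φ t p D (gT mk gx κ Φ t p D) (fT mk fx κ Φ t p D) + 1)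
    (x : Site 2) (du : MDir) (hd : du.1 = 1) (j : ℕ) (hj : j < P.K) (z : Site 2) {E : ℕ} {kE : ℤ}
    (hlev1 : P.faceL 1 j - E ≤ P.lev du x z)
    (hlev2 : P.lev du x z ≤ P.faceL 1 j + E)
    (hz : |z 0 - P.cenS x 0| ≤ kE)
    (hEu : (E : ℤ) ≤ u₁A κ Φ t p D (gT mk gx κ Φ t p D) (fT mk fx κ Φ t p D)) (hE2 : (E : ℤ) ≤ 2 * (KS0.R'0 κ Φ t p D mk : ℤ))
    (hkE : kE ≤ 5 * (P.r 0 : ℤ))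
    (hkE8 : kE + 8 * u₀A κ Φ t p D (gT mk gx κ Φ t p D) (fT mk fx κ Φ t p D) + 8 + P.c 1 ≤ 5 * (P.r 0 : ℤ))
    (hkE24h : 2 * kE + 24 * u₀A κ Φ t p D (gT mk gx κ Φ t p D) (fT mk fx κ Φ t p D) + 24 + 2 * (P.c 1 : ℤ) ≤ 5 * (P.r 0 : ℤ))
    (σh : ℤ) (hσh : σh = 1 ∨ σh = -1) (hhopLo : sgOf du * σh = 1 → 0 ≤ vL κ Φ t p D (gT mk gx κ Φ t p D) (fT mk fx κ Φ t p D)) (hhopHi : sgOf du * σh = -1 → vL κ Φ t p D (gT mk gx κ Φ t p D) (fT mk fx κ Φ t p D) ≤ 0)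
    (hc : NrY κ Φ t p D (gT mk gx κ Φ t p D) (fT mk fx κ Φ t p D) P (yLFs κ Φ t p D c mk (gT mk gx κ Φ t p D) (fT mk fx κ Φ t p D) (sgOf du) σh) x du z + 1 ≤ c)
    (r : ℕ) (hr : πBudY κ Φ t p D c mk (gT mk gx κ Φ t p D) (fT mk fx κ Φ t p D) ≤ r) :
    Skelφ.FloorsY2T (prFA κ Φ t p D (gT mk gx κ Φ t p D) (fT mk fx κ Φ t p D)) (nL κ Φ t p D (gT mk gx κ Φ t p D) (fT mk fx κ Φ t p D)) (u₀A κ Φ t p D (gT mk gx κ Φ t p D) (fT mk fx κ Φ t p D)) (u₁A κ Φ t p D (gT mk gx κ Φ t p D) (fT mk fx κ Φ t p D))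
      (modulus (nL κ Φ t p D (gT mk gx κ Φ t p D) (fT mk fx κ Φ t p D)) (hL κ Φ t p D (gT mk gx κ Φ t p D) (fT mk fx κ Φ t p D)) (vL κ Φ t p D (gT mk gx κ Φ t p D) (fT mk fx κ Φ t p D)) (vβL κ Φ t p D (gT mk gx κ Φ t p D) (fT mk fx κ Φ t p D))) (nL κ Φ t p D (gT mk gx κ Φ t p D) (fT mk fx κ Φ t p D) : ℤ) (ℓL κ Φ t p D (gT mk gx κ Φ t p D) (fT mk fx κ Φ t p D))
      P (NegB.BSlot.small κ Φ t p D (gT mk gx κ Φ t p D) (fT mk fx κ Φ t p D)) x du j 3 r (Mu D) z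
      (fun i => if i = 0 then kF₀A κ Φ t p D c mk (gT mk gx κ Φ t p D) (fT mk fx κ Φ t p D) else kF₁A κ Φ t p D c mk (gT mk gx κ Φ t p D) (fT mk fx κ Φ t p D))
      σh (BFs κ Φ t p D c mk (gT mk gx κ Φ t p D) (fT mk fx κ Φ t p D) σh) (KS0.R'0 κ Φ t p D mk) (qBF κ Φ t p D c mk (gT mk gx κ Φ t p D) (fT mk fx κ Φ t p D)) (KS0.R'0 κ Φ t p D mk) (qB3YA κ Φ t p D (gT mk gx κ Φ t p D) (fT mk fx κ Φ t p D) (KS0.R'0 κ Φ t p D mk))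
      (yLFs κ Φ t p D c mk (gT mk gx κ Φ t p D) (fT mk fx κ Φ t p D) (sgOf du) σh) (NrY κ Φ t p D (gT mk gx κ Φ t p D) (fT mk fx κ Φ t p D) P (yLFs κ Φ t p D c mk (gT mk gx κ Φ t p D) (fT mk fx κ Φ t p D) (sgOf du) σh) x du z) (N3Y κ Φ t p D (gT mk gx κ Φ t p D) (fT mk fx κ Φ t p D) P (yLFs κ Φ t p D c mk (gT mk gx κ Φ t p D) (fT mk fx κ Φ t p D) (sgOf du) σh) x du z) (σTY κ Φ t p D (gT mk gx κ Φ t p D) (fT mk fx κ Φ t p D) P (yLFs κ Φ t p D c mk (gT mk gx κ Φ t p D) (fT mk fx κ Φ t p D) (sgOf du) σh) x du z) := by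
  have hσ : sgOf du = 1 ∨ sgOf du = -1 := sgOf_sign du
  have hR0' : (0 : ℤ) ≤ (KS0.R'0 κ Φ t p D mk : ℤ) := by positivity
  have hs1' : 6 * (KS0.R'0 κ Φ t p D mk : ℤ) + 11 ≤ u₁A κ Φ t p D (gT mk gx κ Φ t p D) (fT mk fx κ Φ t p D) := by linarith
  obtain ⟨-, hsP, -⟩ := cells_of_hP κ Φ t p D (gT mk gx κ Φ t p D) (fT mk fx κ Φ t p D) P hP
  have es0 : ((P.s 0 : ℕ) : ℤ) = u₀A κ Φ t p D (gT mk gx κ Φ t p D) (fT mk fx κ Φ t p D) := by rw [hsP 0]; rfl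
  have es1 : ((P.s 1 : ℕ) : ℤ) = u₁A κ Φ t p D (gT mk gx κ Φ t p D) (fT mk fx κ Φ t p D) := by rw [hsP 1]; rfl
  have hqB2 := two_U_qBF_le κ Φ t p D c mk (gT mk gx κ Φ t p D) (fT mk fx κ Φ t p D) hN hκ
  have hyl := (hyl_yLF κ Φ t p D c mk gx (fT mk fx κ Φ t p D) hN hκ hS hMR0 hσ hσh).1
  obtain ⟨hΛ₀, hΛ₁⟩ := Λ_yLFs κ Φ t p D c mk gx (fT mk fx κ Φ t p D) hN hκ hS hMR0 hσ hσh
  have hσT : (σTY κ Φ t p D (gT mk gx κ Φ t p D) (fT mk fx κ Φ t p D) P (yLFs κ Φ t p D c mk (gT mk gx κ Φ t p D) (fT mk fx κ Φ t p D) (sgOf du) σh) x du z) = 1 ∨ (σTY κ Φ t p D (gT mk gx κ Φ t p D) (fT mk fx κ Φ t p D) P (yLFs κ Φ t p D c mk (gT mk gx κ Φ t p D) (fT mk fx κ Φ t p D) (sgOf du) σh) x du z) = -1 := (N3Y_spec κ Φ t p D (gT mk gx κ Φ t p D) (fT mk fx κ Φ t p D) P (yLFs κ Φ t p D c mk (gT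 mk gx κ Φ t p D) (fT mk fx κ Φ t p D) (sgOf du) σh) x du z).1
  have he0 : |FcA κ Φ t p D (gT mk gx κ Φ t p D) (fT mk fx κ Φ t p D) (yLFs κ Φ t p D c mk (gT mk gx κ Φ t p D) (fT mk fx κ Φ t p D) (sgOf du) σh)| ≤ 5 * u₀A κ Φ t p D (gT mk gx κ Φ t p D) (fT mk fx κ Φ t p D) := abs_FcA_le_of_Λ₀ κ Φ t p D (gT mk gx κ Φ t p D) (fT mk fx κ Φ t p D) hN (yLFs κ Φ t p D c mk (gT mk gx κ Φ t p D) (fT mk fx κ Φ t p D) (sgOf du) σh) hΛ₀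
  have he1 : |F1cA κ Φ t p D (gT mk gx κ Φ t p D) (fT mk fx κ Φ t p D) (yLFs κ Φ t p D c mk (gT mk gx κ Φ t p D) (fT mk fx κ Φ t p D) (sgOf du) σh)| ≤ 2 * u₁A κ Φ t p D (gT mk gx κ Φ t p D) (fT mk fx κ Φ t p D) := abs_F1cA_le_of_Λ₁ κ Φ t p D (gT mk gx κ Φ t p D) (fT mk fx κ Φ t p D) hN (yLFs κ Φ t p D c mk (gT mk gx κ Φ t p D) (fT mk fx κ Φ t p D) (sgOf du) σh) hΛ₁
  have hu0 : 1 ≤ u₀A κ Φ t p D (gT mk gx κ Φ t p D) (fT mk fx κ Φ t p D) := (units_eqA κ Φ t p D (gT mk gx κ Φ t p D) (fT mk fx κ Φ t p D)).2.2.2.2.1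
  have hu1 : 1 ≤ u₁A κ Φ t p D (gT mk gx κ Φ t p D) (fT mk fx κ Φ t p D) := (units_eqA κ Φ t p D (gT mk gx κ Φ t p D) (fT mk fx κ Φ t p D)).2.2.2.2.2
  have he0' : |FcA κ Φ t p D (gT mk gx κ Φ t p D) (fT mk fx κ Φ t p D) (yLFs κ Φ t p D c mk (gT mk gx κ Φ t p D) (fT mk fx κ Φ t p D) (sgOf du) σh)| ≤ 6 * u₀A κ Φ t p D (gT mk gx κ Φ t p D) (fT mk fx κ Φ t p D) := by linarith
  have he1' : |F1cA κ Φ t p D (gT mk gx κ Φ t p D) (fT mk fx κ Φ t p D) (yLFs κ Φ t p D c mk (gT mk gx κ Φ t p D) (fT mk fx κ Φ t p D) (sgOf du) σh)| ≤ 6 * u₁A κ Φ t p D (gT mk gx κ Φ t p D) (fT mk fx κ Φ t p D) := by linarith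
  obtain ⟨hX, hNr⟩ := NrY_range κ Φ t p D (gT mk gx κ Φ t p D) (fT mk fx κ Φ t p D) P hP x du hd z hj hlev1 hlev2 (yLFs κ Φ t p D c mk (gT mk gx κ Φ t p D) (fT mk fx κ Φ t p D) (sgOf du) σh) he1 (by linarith)
  have hN3 := N3Y_range κ Φ t p D (gT mk gx κ Φ t p D) (fT mk fx κ Φ t p D) P hP (yLFs κ Φ t p D c mk (gT mk gx κ Φ t p D) (fT mk fx κ Φ t p D) (sgOf du) σh) x du hd z hz hkE he0 (by linarith)
  have hΛ₁3 : |Λ₁of κ Φ t p D (gT mk gx κ Φ t p D) (fT mk fx κ Φ t p D) (yLFs κ Φ t p D c mk (gT mk gx κ Φ t p D) (fT mk fx κ Φ t p D) (sgOf du) σh)| ≤ 3 * modulus (nL κ Φ t p D (gT mk gx κ Φ t p D) (fT mk fx κ Φ t p D)) (hL κ Φ t p D (gT mk gx κ Φ t p D) (fT mk fx κ Φ t p D)) (vL κ Φ t p D (gT mk gx κ Φ t p D) (fT mk fx κ Φ t p D)) (vβL κ Φ t p D (gT mk gx κ Φ t p D) (fT mk fx κ Φ t p D)) :=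
    hΛ₁.trans (by linarith [abs_nonneg (Λ₁of κ Φ t p D (gT mk gx κ Φ t p D) (fT mk fx κ Φ t p D) (yLFs κ Φ t p D c mk (gT mk gx κ Φ t p D) (fT mk fx κ Φ t p D) (sgOf du) σh))])
  have hqB4 := four_U_qBF_le κ Φ t p D c mk (gT mk gx κ Φ t p D) (fT mk fx κ Φ t p D) hN hκ hS hℓA
  have hNr1000 : NrY κ Φ t p D (gT mk gx κ Φ t p D) (fT mk fx κ Φ t p D) P (yLFs κ Φ t p D c mk (gT mk gx κ Φ t p D) (fT mk fx κ Φ t p D) (sgOf du) σh) x du z + 1 ≤ 1000 * Neg.Kq κ := by have := Neg.one_le_Kq κ; omega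
  have hkE24 : 2 * kE + 24 * u₀A κ Φ t p D (gT mk gx κ Φ t p D) (fT mk fx κ Φ t p D) + 24 + 2 * (P.c 1 : ℤ) ≤ 5 * (P.r 0 : ℤ) := hkE24h
  refine ⟨?_, ?_, hσT, ?_, ?_, ?_, ?_, ?_, ?_, ?_, ?_, ?_, ?_, ?_, ?_, ?_, ?_, ?_, ?_, ?_, ?_, hσh, ?_, ?_, ?_, ?_, ?_, ?_, ?_⟩
  · exact hfR_YA κ Φ t p D c mk (gT mk gx κ Φ t p D) (fT mk fx κ Φ t p D) P hP x du hd j (by exact hj) z (by rw [hd]; exact hlev1) (by rw [hd]; exact hlev2) hz hEu hkF0 hkF1 hs1 hkE8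
  · exact hZfar_YA κ Φ t p D c mk (gT mk gx κ Φ t p D) (fT mk fx κ Φ t p D) P hP x du hd j hj z (by rw [hd]; exact hlev2) hEu hkF1
  · intro hσ1 k hk; rw [hd]; try rw [es1]
    exact (floorsFA_YA κ Φ t p D (gT mk gx κ Φ t p D) (fT mk fx κ Φ t p D) mk P hP hN hκ hℓA hs1' x du hd j hj z hlev1 hlev2 hE2 (yLFs κ Φ t p D c mk (gT mk gx κ Φ t p D) (fT mk fx κ Φ t p D) (sgOf du) σh) he1' hΛ₁3 hqB4).1 hσ1 k hk
  · intro hσ1 k hk; rw [hd]; try rw [es1]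
    exact (floorsFA_YA κ Φ t p D (gT mk gx κ Φ t p D) (fT mk fx κ Φ t p D) mk P hP hN hκ hℓA hs1' x du hd j hj z hlev1 hlev2 hE2 (yLFs κ Φ t p D c mk (gT mk gx κ Φ t p D) (fT mk fx κ Φ t p D) (sgOf du) σh) he1' hΛ₁3 hqB4).2.1 hσ1 k hk
  · intro hσ1 k hk; rw [hd]; try rw [es1]
    exact (floorsFA_YA κ Φ t p D (gT mk gx κ Φ t p D) (fT mk fx κ Φ t p D) mk P hP hN hκ hℓA hs1' x du hd j hj z hlev1 hlev2 hE2 (yLFs κ Φ t p D c mk (gT mk gx κ Φ t p D) (fT mk fx κ Φ t p D) (sgOf du) σh) he1' hΛ₁3 hqB4).2.2.1 hσ1 k hk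
  · intro hσ1 k hk; rw [hd]; try rw [es1]
    exact (floorsFA_YA κ Φ t p D (gT mk gx κ Φ t p D) (fT mk fx κ Φ t p D) mk P hP hN hκ hℓA hs1' x du hd j hj z hlev1 hlev2 hE2 (yLFs κ Φ t p D c mk (gT mk gx κ Φ t p D) (fT mk fx κ Φ t p D) (sgOf du) σh) he1' hΛ₁3 hqB4).2.2.2 hσ1 k hk
  · intro k hk; rw [hd]; exact (floorsFB_YA κ Φ t p D (gT mk gx κ Φ t p D) (fT mk fx κ Φ t p D) mk P hN hκ hnA hℓA x z (yLFs κ Φ t p D c mk (gT mk gx κ Φ t p D) (fT mk fx κ Φ t p D) (sgOf du) σh) he0' hz hkE24 hqB4 hNr1000).1 k hk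
  · intro k hk; rw [hd]; exact (floorsFB_YA κ Φ t p D (gT mk gx κ Φ t p D) (fT mk fx κ Φ t p D) mk P hN hκ hnA hℓA x z (yLFs κ Φ t p D c mk (gT mk gx κ Φ t p D) (fT mk fx κ Φ t p D) (sgOf du) σh) he0' hz hkE24 hqB4 hNr1000).2 k hk
  · intro hσ1 k hk; rw [hd]; try rw [es1]
    exact (floorsFT_YA κ Φ t p D (gT mk gx κ Φ t p D) (fT mk fx κ Φ t p D) mk P hP hN hκ hnA hℓA hs0 hs1' x du hd j hj z hlev1 hlev2 hE2 hz hkE hkE24 (yLFs κ Φ t p D c mk (gT mk gx κ Φ t p D) (fT mk fx κ Φ t p D) (sgOf du) σh) he0' he1').1 hσ1 k hk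
  · intro hσ1 k hk; rw [hd]; try rw [es1]
    exact (floorsFT_YA κ Φ t p D (gT mk gx κ Φ t p D) (fT mk fx κ Φ t p D) mk P hP hN hκ hnA hℓA hs0 hs1' x du hd j hj z hlev1 hlev2 hE2 hz hkE hkE24 (yLFs κ Φ t p D c mk (gT mk gx κ Φ t p D) (fT mk fx κ Φ t p D) (sgOf du) σh) he0' he1').2.1 hσ1 k hk
  · intro hσ1 k hk; rw [hd]; try rw [es1]
    exact (floorsFT_YA κ Φ t p D (gT mk gx κ Φ t p D) (fT mk fx κ Φ t p D) mk P hP hN hκ hnA hℓA hs0 hs1' x du hd j hj z hlev1 hlev2 hE2 hz hkE hkE24 (yLFs κ Φ t p D c mk (gT mk gx κ Φ t p D) (fT mk fx κ Φ t p D) (sgOf du) σh) he0' he1').2.2.1 hσ1 k hk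
  · intro hσ1 k hk; rw [hd]; try rw [es1]
    exact (floorsFT_YA κ Φ t p D (gT mk gx κ Φ t p D) (fT mk fx κ Φ t p D) mk P hP hN hκ hnA hℓA hs0 hs1' x du hd j hj z hlev1 hlev2 hE2 hz hkE hkE24 (yLFs κ Φ t p D c mk (gT mk gx κ Φ t p D) (fT mk fx κ Φ t p D) (sgOf du) σh) he0' he1').2.2.2.1 hσ1 k hk
  · intro k hk; rw [hd]; try rw [es1]
    exact (floorsFT_YA κ Φ t p D (gT mk gx κ Φ t p D) (fT mk fx κ Φ t p D) mk P hP hN hκ hnA hℓA hs0 hs1' x du hd j hj z hlev1 hlev2 hE2 hz hkE hkE24 (yLFs κ Φ t p D c mk (gT mk gx κ Φ t p D) (fT mk fx κ Φ t p D) (sgOf du) σh) he0' he1').2.2.2.2.1 k hk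
  · intro k hk; rw [hd]; try rw [es1]
    exact (floorsFT_YA κ Φ t p D (gT mk gx κ Φ t p D) (fT mk fx κ Φ t p D) mk P hP hN hκ hnA hℓA hs0 hs1' x du hd j hj z hlev1 hlev2 hE2 hz hkE hkE24 (yLFs κ Φ t p D c mk (gT mk gx κ Φ t p D) (fT mk fx κ Φ t p D) (sgOf du) σh) he0' he1').2.2.2.2.2 k hk
  · have h := (floorsFL_YA κ Φ t p D (gT mk gx κ Φ t p D) (fT mk fx κ Φ t p D) mk P hP hN hκ hnA hℓA hs0 hs1' x du hd j hj z hlev1 hlev2 hE2 hz hkE (yLFs κ Φ t p D c mk (gT mk gx κ Φ t p D) (fT mk fx κ Φ t p D) (sgOf du) σh) he0' he1').1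
    try rw [es0] at h
    exact h
  · have h := (floorsFL_YA κ Φ t p D (gT mk gx κ Φ t p D) (fT mk fx κ Φ t p D) mk P hP hN hκ hnA hℓA hs0 hs1' x du hd j hj z hlev1 hlev2 hE2 hz hkE (yLFs κ Φ t p D c mk (gT mk gx κ Φ t p D) (fT mk fx κ Φ t p D) (sgOf du) σh) he0' he1').2.1
    try rw [es0] at h
    exact h
  · have h := (floorsFL_YA κ Φ t p D (gT mk gx κ Φ t p D) (fT mk fx κ Φ t p D) mk P hP hN hκ hnA hℓA hs0 hs1' x du hd j hj z hlev1 hlev2 hE2 hz hkE (yLFs κ Φ t p D c mk (gT mk gx κ Φ t p D) (fT mk fx κ Φ t p D) (sgOf du) σh) he0' he1').2.2.1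
    try rw [es0] at h
    exact h
  · have h := (floorsFL_YA κ Φ t p D (gT mk gx κ Φ t p D) (fT mk fx κ Φ t p D) mk P hP hN hκ hnA hℓA hs0 hs1' x du hd j hj z hlev1 hlev2 hE2 hz hkE (yLFs κ Φ t p D c mk (gT mk gx κ Φ t p D) (fT mk fx κ Φ t p D) (sgOf du) σh) he0' he1').2.2.2
    try rw [es0] at h
    exact h
  · exact hq₃Y_RA κ Φ t p D (gT mk gx κ Φ t p D) (fT mk fx κ Φ t p D) (KS0.R'0 κ Φ t p D mk) hNr1000
  · exact hW_YA₂ κ Φ t p D c mk (gT mk gx κ Φ t p D) (fT mk fx κ Φ t p D) hN hκ hℓA hS64 hNr hqB2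
  · exact hxaF_s κ Φ t p D c mk gx fx hRn0 hN hσ hσh
  · exact hxbF_s κ Φ t p D c mk gx fx hN hσ hσh
  · exact hclrLo_YFs κ Φ t p D c mk (gT mk gx κ Φ t p D) (fT mk fx κ Φ t p D) hN du hhopLo hc
  · exact hclrHi_YFs κ Φ t p D c mk (gT mk gx κ Φ t p D) (fT mk fx κ Φ t p D) hN du hhopHi hc
  · exact hclr₃_YA κ Φ t p D mk (gT mk gx κ Φ t p D) (fT mk fx κ Φ t p D) P hP hN hκ hℓA x du hd j hj z hlev1 hlev2 hz hEu hkE (yLFs κ Φ t p D c mk (gT mk gx κ Φ t p D) (fT mk fx κ Φ t p D) (sgOf du) σh) he0' he1' _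
  · exact hπ2Y_YA κ Φ t p D c mk (gT mk gx κ Φ t p D) (fT mk fx κ Φ t p D) P hP hN hκ hℓA x du hd j hj z hlev1 hlev2 hEu (yLFs κ Φ t p D c mk (gT mk gx κ Φ t p D) (fT mk fx κ Φ t p D) (sgOf du) σh) he1' hyl _ r hr
  · exact hπ3Y_YA κ Φ t p D c mk (gT mk gx κ Φ t p D) (fT mk fx κ Φ t p D) P hP hN hκ hℓA x du hd j hj z hlev1 hlev2 hz hEu hkE (yLFs κ Φ t p D c mk (gT mk gx κ Φ t p D) (fT mk fx κ Φ t p D) (sgOf du) σh) he0' he1' hyl r hr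


/-- **The y′ counts' ranges at the origin `yLFs`** (per point; what the packager reads for the capped witnesses): `NrY + 1 ≤ 600·Kq` and
`N3Y + 1 ≤ 240·Kq + 10` (N2: creep-aware tangential range). [folklore] -/
theorem rangesY_YFs (κ : Consts) {V : Type} [DecidableEq V] [Countable V] {G : SimpleGraph V} [G.LocallyFinite] (Φ : PlanarSkeletonFrm G) (t : V) (p : unitInterval) (D : Skelφ.StepI.DataNS V) (c : ℕ) (mk : ℕ) (gx : Neg.FSlot) (fx : Neg.FSlot) (P : PCells2T) (hP : P.toPCells2 = fcellsA κ Φ t p D (gT mk gx κ Φ t p D) (fT mk fx κ Φ t p D))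
    (hN : EqNumL κ Φ t p D (gT mk gx κ Φ t p D) (fT mk fx κ Φ t p D)) (hκ : (hL κ Φ t p D (gT mk gx κ Φ t p D) (fT mk fx κ Φ t p D)).natAbs ≤ 10 * nL κ Φ t p D (gT mk gx κ Φ t p D) (fT mk fx κ Φ t p D))
    (hS : 16 * SF κ Φ t p D c mk ≤ ML κ Φ t p D (gT mk gx κ Φ t p D)) (hMR0 : 22000 * (KS0.R'0 κ Φ t p D mk + 2) ≤ ML κ Φ t p D (gT mk gx κ Φ t p D))
    (x : Site 2) (du : MDir) (hd : du.1 = 1) (j : ℕ) (hj : j < P.K) (z : Site 2) {E : ℕ} {kE : ℤ}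
    (hlev1 : P.faceL 1 j - E ≤ P.lev du x z) (hlev2 : P.lev du x z ≤ P.faceL 1 j + E)
    (hz : |z 0 - P.cenS x 0| ≤ kE) (hEu : (E : ℤ) ≤ u₁A κ Φ t p D (gT mk gx κ Φ t p D) (fT mk fx κ Φ t p D)) (hkE : kE ≤ 5 * (P.r 0 : ℤ))
    (σh : ℤ) (hσh : σh = 1 ∨ σh = -1) :
    NrY κ Φ t p D (gT mk gx κ Φ t p D) (fT mk fx κ Φ t p D) P (yLFs κ Φ t p D c mk (gT mk gx κ Φ t p D) (fT mk fx κ Φ t p D) (sgOf du) σh) x du z + 1 ≤ 600 * Neg.Kq κ ∧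
      N3Y κ Φ t p D (gT mk gx κ Φ t p D) (fT mk fx κ Φ t p D) P (yLFs κ Φ t p D c mk (gT mk gx κ Φ t p D) (fT mk fx κ Φ t p D) (sgOf du) σh) x du z + 1 ≤ 240 * Neg.Kq κ + 10 := by
  have hσ : sgOf du = 1 ∨ sgOf du = -1 := sgOf_sign du
  obtain ⟨he0, he1, -⟩ := he_yLFs κ Φ t p D c mk gx (fT mk fx κ Φ t p D) hN hκ hS hMR0 hσ hσh
  have hu1 : 1 ≤ u₁A κ Φ t p D (gT mk gx κ Φ t p D) (fT mk fx κ Φ t p D) := (units_eqA κ Φ t p D (gT mk gx κ Φ t p D) (fT mk fx κ Φ t p D)).2.2.2.2.2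
  have hu0 : 1 ≤ u₀A κ Φ t p D (gT mk gx κ Φ t p D) (fT mk fx κ Φ t p D) := (units_eqA κ Φ t p D (gT mk gx κ Φ t p D) (fT mk fx κ Φ t p D)).2.2.2.2.1
  exact ⟨(NrY_range κ Φ t p D (gT mk gx κ Φ t p D) (fT mk fx κ Φ t p D) P hP x du hd z hj hlev1 hlev2 (yLFs κ Φ t p D c mk (gT mk gx κ Φ t p D) (fT mk fx κ Φ t p D) (sgOf du) σh) he1 (by linarith)).2,
    N3Y_range κ Φ t p D (gT mk gx κ Φ t p D) (fT mk fx κ Φ t p D) P hP (yLFs κ Φ t p D c mk (gT mk gx κ Φ t p D) (fT mk fx κ Φ t p D) (sgOf du) σh) x du hd z hz hkE he0 (by linarith)⟩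

end KS

end NegB

end PlanarSkeletonFrm

end Summit.CriticalPhenomena.PercolationContinuityZ3.Theorems.Transplant

end
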